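/-
Copyright (c) 2026 the pub-hodgecm-mathlib formalisation cell (harness21).  Prover seat hodgecm-mathlib-F0P3a-p02 (g23): the CLOSED sequel of ★ p851982
`DepthZeroKappaTransferTypeOneRowZeroTrace` ((C6)-4, LH4-plan (g7) WORDS #18∕#34), 2026-09-02.
-/
import Literature.NumberTheory.Rogawski1990.DepthZeroKappaTransferTypeOneRowZeroTrace                -- ★ p851982 (this seat): the two `…_of_count` heads
import Literature.NumberTheory.Rogawski1990.UnitOrbitalIntegralInertValueThetaZeroAdicCompletionTrace   -- ★ p852252 (this seat): the θ̄ = 0 EXPORT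
import Literature.NumberTheory.Rogawski1990.UnitOrbitalIntegralInertValueThetaOneAdicCompletionTrace    -- ★ (this seat): the θ̄ = 1 EXPORT
import HarnessLib

/-!
# The depth-zero κ-transfer, type (1): ROW 0 per TRACE literal, CLOSED — `n₀(t_π^{(b)}(x)) = φ₁(Q₁ − 1, P − 1)`, `n₀(t_1^{(b)}(x)) = φ₀(Q₁ − 1, Q₂ − 1, P − 1)`
# at EVERY residue characteristic (Rogawski 1990 Prop. 4.9.1 (b); Kottwitz 1986 §3; Flicker 1998 Props. 11, 14)

Topic `NumberTheory/Rogawski1990`; namespace `Literature.NumberTheory.Rogawski1990`.  THEOREMS ONLY (no definition, no instance, no notation, no named fact,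
no `sorry`); kernel lane `--supports stmt-HodgeConjecture-24833`.  Cell `pub/hodgecm-mathlib`, crux H413; LH4 board (D-UNR), LAYER C readers: the CLOSED sequel of
(C6)-4 ★ p851982 `DepthZeroKappaTransferTypeOneRowZeroTrace` (LH4-plan (g7) WORD #34: «variant (A) now, `…Closed` when the exports ★»).

WHAT.  ★ p851982 proves ROW 0 in the trace frame MODULO the inert count at `L_w` (hypotheses `hX₁`∕`hX₀` = the (C5)′ EXPORT texts in the (R-ord) binder order of
record).  Here the two hypotheses are DISCHARGED by the (C5)′ EXPORTS `natCard_fixedPoints_unitaryInt_traceTorusPi_eq_phiOne_adicCompletion` ∕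
`natCard_fixedPoints_unitaryInt_traceTorus_eq_phiZero_adicCompletion` (this seat, `UnitOrbitalIntegralInertValueTheta{One,Zero}AdicCompletionTrace`), giving the two
CLOSED heads in exactly the binders of ★ p851882 `hCPi`∕`hCOne`'s ROW-0 conjuncts plus `(hbv) (hbδ)`:
* **`ncard_rankStratum_zero_eq_phiOne_of_congr_traceTorusEltPi`** (θ̄ = 1) and **`ncard_rankStratum_zero_eq_phiZero_of_congr_traceTorusElt`** (θ̄ = 0) — the twins of ★
  `ncard_rankStratum_zero_eq_phiOne∕phiZero_of_congr` with `h2 {e y} h2e hy` DELETED, `{b} (hb) (hbv) (hbδ)` ADDED; consumed by (C6)-6 `…CountsTrace` (LH5-p01).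
HONEST LABEL: HC_CM is proved only modulo the 7 printed citations (2 remaining: hLiu418 = stmt-HodgeConjecture-24832, h413 = stmt-HodgeConjecture-24833) until rung 0
closes; count-neutral ((D-UNR) PRINT by D74′); pays no organ, opens no road.

## References
* [Rogawski1990] J. D. Rogawski, *Automorphic Representations of Unitary Groups in Three Variables* (1990), §4.9 p. 54, Prop. 4.9.1 (b) p. 55.
* [Kottwitz1986] R. E. Kottwitz, *Base change for unit elements of Hecke algebras*, Compositio Math. 60 (1986), §3.
* [Flicker1998UnitaryFL] Y. Z. Flicker, *Elementary proof of the fundamental lemma for a unitary group*, Canad. J. Math. 50 (1998), Prop. 11 p. 87, Prop. 14 p. 94.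
-/

set_option autoImplicit false

noncomputable section

open MeasureTheory Measure Set Function NumberField IsDedekindDomain Matrix Polynomial
open Literature.NumberTheory.Automorphic Literature.NumberTheory.Automorphic.UnitaryGroup
open Literature.NumberTheory.Automorphic.IntegralReduction Literature.NumberTheory.GaloisRepresentations
open Literature.NumberTheory.Automorphic.HermitianLattice (unitaryInt)
open Literature.NumberTheory.Rogawski1990.Flicker1998 (phiZero phiOne)
open scoped Matrix MatrixGroups ValuativeRel

/-! ## §1 The CLOSED heads -/

namespace Literature.NumberTheory.Rogawski1990

section Heads

variable (L : Type) [Field L] [NumberField L] [IsCMField L] (H' : Matrix (Fin 3) (Fin 3) L)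
  {v : HeightOneSpectrum (𝓞 ↥(maximalRealSubfield L))}

set_option synthInstance.maxHeartbeats 200000 in  -- the coset action `U_w ↷ U_w ⧸ unitaryInt` (as in ★ `FixedCosetsTransport`)
set_option maxHeartbeats 400000 in  -- the heavy one-place carriers
open scoped Classical in
/-- **ROW 0 AT A θ̄ = 1 TRACE LITERAL, EVERY RESIDUE CHARACTERISTIC, CLOSED (measure-free)**: for `t ∈ G′_v` congruent to `t_π^{(b)}(x₁,x₂,x₃)` (`b + σb = 1`, `|b|_w ≤ 1`,
`|σb − b|_w = 1`; `x_i` pairwise distinct of norm one and ≡ 1 (mod 𝔪_w)) at an inert UNRAMIFIED `v` — `v ∣ 2` allowed —: **`n₀(t) = φ₁(Q₁ − 1, P − 1)`**.  ★ p851982's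
`…_of_count` with its hypothesis `hX₁` discharged by the (C5)′ θ̄ = 1 EXPORT `natCard_fixedPoints_unitaryInt_traceTorusPi_eq_phiOne_adicCompletion`.  Twin of ★
`ncard_rankStratum_zero_eq_phiOne_of_congr` (`h2 {e y} h2e hy` DELETED, `{b} (hb) (hbv) (hbδ)` ADDED) = the ROW-0 conjunct of ★ p851882 `hCPi`.
[cite: Rogawski1990, §4.9 p. 54, Prop. 4.9.1 (b) p. 55] [cite: Kottwitz1986, §3] [cite: Flicker1998UnitaryFL, Prop. 11 p. 87] -/
theorem ncard_rankStratum_zero_eq_phiOne_of_congr_traceTorusEltPi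
    (hH' : (H'.map (IsCMField.complexConj L))ᵀ = H') (hH'u : IsUnit H') (w : PlacesOver L v)
    (hw : IsCMField.complexConj L • w.1 = w.1) (hv : Algebra.IsUnramifiedIn (𝓞 L) v.asIdeal)
    {b π π' x₁ x₂ x₃ : LocalRing L v} (hb : b + conjLocal L (IsCMField.complexConj L) v b = 1)
    (hbv : Valued.v (b w) ≤ 1) (hbδ : Valued.v ((conjLocal L (IsCMField.complexConj L) v b - b) w) = 1)
    (hσπ : conjLocal L (IsCMField.complexConj L) v π = π) (hππ : π * π' = 1)
    (hπN : ∀ z : LocalRing L v, conjLocal L (IsCMField.complexConj L) v z * z ≠ π)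
    (hx₁ : conjLocal L (IsCMField.complexConj L) v x₁ * x₁ = 1) (hx₂ : conjLocal L (IsCMField.complexConj L) v x₂ * x₂ = 1)
    (hx₃ : conjLocal L (IsCMField.complexConj L) v x₃ * x₃ = 1) (h₁₂ : x₁ ≠ x₂) (h₂₃ : x₂ ≠ x₃) (h₁₃ : x₁ ≠ x₃)
    (Tl : GL (Fin 3) (LocalRing L v))
    (ψ : ↥(UnitaryGroup.«local» L (IsCMField.complexConj L) 3 H' v) ≃ₜ*
        ↥(UnitaryGroup.«local» L (IsCMField.complexConj L) 3 (Matrix.of fun i j : Fin 3 => if i.val + j.val + 1 = 3 then (1 : L) else 0) v))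
    (t : (cmDatum L 3 H').Local v)
    (hψ : ∀ g, (ψ g).val = Tl * g.val * Tl⁻¹)
    (hlev : ∀ g, g ∈ cmLocalIntegralLevel L 3 H' v ↔
        ψ g ∈ cmLocalIntegralLevel L 3 (Matrix.of fun i j : Fin 3 => if i.val + j.val + 1 = 3 then (1 : L) else 0) v)
    (hlit : (ψ t).val.val =
          !![x₁ * conjLocal L (IsCMField.complexConj L) v b + x₃ * b, 0, π * (x₁ - x₃); 0, x₂, 0;
            π' * (b * conjLocal L (IsCMField.complexConj L) v b * (x₁ - x₃)), 0, x₁ * b + x₃ * conjLocal L (IsCMField.complexConj L) v b])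
    {P Q₁ Q₂ : ℕ} (hP : Valued.v (x₁ w - x₃ w) = WithZero.exp (-(P : ℤ))) (hQ₁ : Valued.v (x₁ w - x₂ w) = WithZero.exp (-(Q₁ : ℤ)))
    (hQ₂ : Valued.v (x₃ w - x₂ w) = WithZero.exp (-(Q₂ : ℤ)))
    (hd₁ : Valued.v (x₁ w - 1) < 1) (hd₂ : Valued.v (x₂ w - 1) < 1) (hd₃ : Valued.v (x₃ w - 1) < 1) :
    (({q : (cmDatum L 3 H').Local v ⧸ cmLocalIntegralLevel L 3 H' v |
        q ∈ MulAction.fixedBy ((cmDatum L 3 H').Local v ⧸ cmLocalIntegralLevel L 3 H' v) t ∧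
          (redMat ((((q.out⁻¹ * t * q.out : (cmDatum L 3 H').Local v)).val : GL (Fin 3) (LocalRing L v)).val.map
            (Pi.evalRingHom (fun w' : PlacesOver L v => w'.1.adicCompletion L) w)) - 1).rank = 0}.ncard : ℕ) : ℚ) =
      Flicker1998.phiOne (Ideal.absNorm v.asIdeal) (Q₁ - 1) (P - 1) := by
  haveI : IsAdicComplete (IsLocalRing.maximalIdeal (Valued.integer (w.1.adicCompletion L))) (Valued.integer (w.1.adicCompletion L)) :=
    isAdicComplete_maximalIdeal_valuedInteger_adicCompletion L w.1
  exact ncard_rankStratum_zero_eq_phiOne_of_congr_traceTorusEltPi_of_count L H' hH' hH'u w hw hv hb hbv hbδ hσπ hππ hπN hx₁ hx₂ hx₃ h₁₂ h₂₃ h₁₃ Tl ψ t hψ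
    hlev hlit hP hQ₁ hQ₂ hd₁ hd₂ hd₃
    (fun {b₀} hb' hbv' hbδ' {y₁ y₂ y₃ π₀ π₀'} hy₁ hy₂ hy₃ hσπ' hππ'' hπN' {t₀} hte {M M₁ M₂} hN hN₁ hN₂ hfin' =>
      natCard_fixedPoints_unitaryInt_traceTorusPi_eq_phiOne_adicCompletion L w hw hv hb' hbv' hbδ' hy₁ hy₂ hy₃ hσπ' hππ'' hπN' hte hN hN₁ hN₂ hfin')

set_option synthInstance.maxHeartbeats 200000 in  -- the coset action `U_w ↷ U_w ⧸ unitaryInt` (as in ★ `FixedCosetsTransport`)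
set_option maxHeartbeats 400000 in  -- the heavy one-place carriers
open scoped Classical in
/-- **ROW 0 AT THE θ̄ = 0 TRACE LITERAL, EVERY RESIDUE CHARACTERISTIC, CLOSED (measure-free)**: for `t ∈ G′_v` congruent to `t_1^{(b)}(x₁,x₂,x₃)` (`b + σb = 1`,
`|b|_w ≤ 1`, `|σb − b|_w = 1`; `x_i` pairwise distinct of norm one and ≡ 1 (mod 𝔪_w); exponents `P, Q₁, Q₂`, two equal and not exceeding the third) at an inert UNRAMIFIED
`v` — `v ∣ 2` allowed —: **`n₀(t) = φ₀(Q₁ − 1, Q₂ − 1, P − 1)`**.  ★ p851982's `…_of_count` with `hX₀` discharged by the (C5)′ θ̄ = 0 EXPORT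
`natCard_fixedPoints_unitaryInt_traceTorus_eq_phiZero_adicCompletion`.  Twin of ★ `ncard_rankStratum_zero_eq_phiZero_of_congr` = the ROW-0 conjunct of ★ p851882 `hCOne`.
[cite: Rogawski1990, §4.9 p. 54, Prop. 4.9.1 (b) p. 55] [cite: Kottwitz1986, §3] [cite: Flicker1998UnitaryFL, Prop. 14 p. 94] -/
theorem ncard_rankStratum_zero_eq_phiZero_of_congr_traceTorusElt
    (hH' : (H'.map (IsCMField.complexConj L))ᵀ = H') (hH'u : IsUnit H') (w : PlacesOver L v)
    (hw : IsCMField.complexConj L • w.1 = w.1) (hv : Algebra.IsUnramifiedIn (𝓞 L) v.asIdeal)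
    {b x₁ x₂ x₃ : LocalRing L v} (hb : b + conjLocal L (IsCMField.complexConj L) v b = 1)
    (hbv : Valued.v (b w) ≤ 1) (hbδ : Valued.v ((conjLocal L (IsCMField.complexConj L) v b - b) w) = 1)
    (hx₁ : conjLocal L (IsCMField.complexConj L) v x₁ * x₁ = 1) (hx₂ : conjLocal L (IsCMField.complexConj L) v x₂ * x₂ = 1)
    (hx₃ : conjLocal L (IsCMField.complexConj L) v x₃ * x₃ = 1) (h₁₂ : x₁ ≠ x₂) (h₂₃ : x₂ ≠ x₃) (h₁₃ : x₁ ≠ x₃)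
    (Tl : GL (Fin 3) (LocalRing L v))
    (ψ : ↥(UnitaryGroup.«local» L (IsCMField.complexConj L) 3 H' v) ≃ₜ*
        ↥(UnitaryGroup.«local» L (IsCMField.complexConj L) 3 (Matrix.of fun i j : Fin 3 => if i.val + j.val + 1 = 3 then (1 : L) else 0) v))
    (t : (cmDatum L 3 H').Local v)
    (hψ : ∀ g, (ψ g).val = Tl * g.val * Tl⁻¹)
    (hlev : ∀ g, g ∈ cmLocalIntegralLevel L 3 H' v ↔
        ψ g ∈ cmLocalIntegralLevel L 3 (Matrix.of fun i j : Fin 3 => if i.val + j.val + 1 = 3 then (1 : L) else 0) v)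
    (hlit : (ψ t).val.val =
          !![x₁ * conjLocal L (IsCMField.complexConj L) v b + x₃ * b, 0, x₁ - x₃; 0, x₂, 0;
            b * conjLocal L (IsCMField.complexConj L) v b * (x₁ - x₃), 0, x₁ * b + x₃ * conjLocal L (IsCMField.complexConj L) v b])
    {P Q₁ Q₂ : ℕ} (hP : Valued.v (x₁ w - x₃ w) = WithZero.exp (-(P : ℤ))) (hQ₁ : Valued.v (x₁ w - x₂ w) = WithZero.exp (-(Q₁ : ℤ)))
    (hQ₂ : Valued.v (x₃ w - x₂ w) = WithZero.exp (-(Q₂ : ℤ)))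
    (htri : (Q₁ = Q₂ ∧ Q₁ ≤ P) ∨ (Q₁ = P ∧ Q₁ ≤ Q₂) ∨ (Q₂ = P ∧ Q₂ ≤ Q₁))
    (hd₁ : Valued.v (x₁ w - 1) < 1) (hd₂ : Valued.v (x₂ w - 1) < 1) (hd₃ : Valued.v (x₃ w - 1) < 1) :
    (({q : (cmDatum L 3 H').Local v ⧸ cmLocalIntegralLevel L 3 H' v |
        q ∈ MulAction.fixedBy ((cmDatum L 3 H').Local v ⧸ cmLocalIntegralLevel L 3 H' v) t ∧
          (redMat ((((q.out⁻¹ * t * q.out : (cmDatum L 3 H').Local v)).val : GL (Fin 3) (LocalRing L v)).val.map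
            (Pi.evalRingHom (fun w' : PlacesOver L v => w'.1.adicCompletion L) w)) - 1).rank = 0}.ncard : ℕ) : ℚ) =
      Flicker1998.phiZero (Ideal.absNorm v.asIdeal) (Q₁ - 1) (Q₂ - 1) (P - 1) := by
  haveI : IsAdicComplete (IsLocalRing.maximalIdeal (Valued.integer (w.1.adicCompletion L))) (Valued.integer (w.1.adicCompletion L)) :=
    isAdicComplete_maximalIdeal_valuedInteger_adicCompletion L w.1
  exact ncard_rankStratum_zero_eq_phiZero_of_congr_traceTorusElt_of_count L H' hH' hH'u w hw hv hb hbv hbδ hx₁ hx₂ hx₃ h₁₂ h₂₃ h₁₃ Tl ψ t hψ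
    hlev hlit hP hQ₁ hQ₂ htri hd₁ hd₂ hd₃
    (fun {b₀} hb' hbv' hbδ' {y₁ y₂ y₃} hy₁ hy₂ hy₃ {t₀} hte {M M₁ M₂} hN hN₁ hN₂ htri' hfin' =>
      natCard_fixedPoints_unitaryInt_traceTorus_eq_phiZero_adicCompletion L w hw hv hb' hbv' hbδ' hy₁ hy₂ hy₃ hte hN hN₁ hN₂ htri' hfin')

end Heads

end Literature.NumberTheory.Rogawski1990

end
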